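import Summits.NavierStokesRegularity.NavierStokesRegularity.Theses.SymmetryModuliCount
import Literature.Analysis.FluidPDE.BurgersVortexLayerSteady

/-!
# Refutation of `SymmetryModuliCount.FiniteTangentModuli` (stmt-NavierStokesRegularity-4055)

The crux claims that around every smooth divergence-free drift `u` on `(-∞,0) × ℝ³` with
`|u| ≤ C/√(-t)`, `‖∇u‖ ≤ C/(-t)`, some `N` makes any `N + 1` tempered classical solutions of the
linearised Navier–Stokes system dependent modulo slice-wise constants.  False (cdisprove seat
`refuter-cdisprove-stmt-NavierStokesRegularity-4055-0`, 2026-08-16): around the decaying Kolmogorov shear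
`u = (1-t)⁻¹ sin(x₀) e₁` (`C = 1`) the FORCED PARASITIC modes `v_k = a^{k+2} cos(x₀) e₁ + B_k(t) e₀`,
`q_k = -B_k' x₀` (`a = (1-t)⁻¹`, `B_k = -((k+2)a^{k+2} + a^{k+1})`, all `k`) are tempered classical solutions
independent modulo slice constants (`∑ c_k a(t)^{k+2} ≡ 0` forces `c = 0`).  See the theorem docstring for the
mechanism and the repaired (mild-gauge) statement.  Shear calculus: in-tree `StrainedShear`.  (Full-build
repair 2026-08-16: the dropped route decl is re-declared below, signature verbatim, so this record elaborates.)
-/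

noncomputable section

open Set Function Filter Topology WithLp MeasureTheory InnerProductSpace
open scoped Laplacian RealInnerProductSpace ContDiff BigOperators

-- (2026-09-04 buildfix: the private re-creation of `…Theses.SymmetryModuliCount.FiniteTangentModuli` that stood here was removed —
--  the route file declares the retired decl again as a tombstone plain def with the verbatim signature (re-render 2026-09-04T10:54Z), so the
--  refutation below elaborates against the route decl; keeping both is a duplicate-declaration error.)

namespace Summit.NavierStokesRegularity.NavierStokesRegularity.Theorems

open Literature.Analysis.FluidPDE Literature.Analysis.FluidPDE.StrainedShear

/-- `e₀ = (1, 0, 0)`: the forced parasitic direction (the drift varies along it). [folklore] -/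
private def eZero : EuclideanSpace ℝ (Fin 3) := EuclideanSpace.single 0 1

/-- Components and norm of `e₀`, norm of `e₁`. [folklore] -/
@[simp] private theorem eZero_apply_zero : eZero 0 = 1 := by simp [eZero]
/-- Components of `e₀`. [folklore] -/
@[simp] private theorem eZero_apply_one : eZero 1 = 0 := by simp [eZero]
/-- `‖e₀‖ = 1`. [folklore] -/
@[simp] private theorem norm_eZero : ‖eZero‖ = 1 := by simp [eZero]
/-- `‖e₁‖ = 1`. [folklore] -/
@[simp] private theorem norm_eOne : ‖eOne‖ = 1 := by simp [eOne]

/-- Drift amplitude `a(t) = (1 - t)⁻¹`. [folklore] -/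
private def amp (t : ℝ) : ℝ := (1 - t)⁻¹
/-- The drift `u(t, x) = a(t) sin(x₀) e₁` (decaying Kolmogorov shear; not a Navier–Stokes solution). [folklore] -/
private def drift (t : ℝ) : EuclideanSpace ℝ (Fin 3) → EuclideanSpace ℝ (Fin 3) :=
  shear (fun s => amp t * Real.sin s)

/-- Parasitic amplitude `B_k = -((k+2) a^{k+2} + a^{k+1})` of the `k`-th mode. [folklore] -/
private def bee (k : ℕ) (t : ℝ) : ℝ := -(((k : ℝ) + 2) * amp t ^ (k + 2) + amp t ^ (k + 1))
/-- `Q_k = -B_k' = (k+2)² a^{k+3} + (k+1) a^{k+2}`. [folklore] -/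
private def cue (k : ℕ) (t : ℝ) : ℝ :=
  ((k : ℝ) + 2) ^ 2 * amp t ^ (k + 3) + ((k : ℝ) + 1) * amp t ^ (k + 2)
/-- The `k`-th mode `v_k(t, x) = a^{k+2} cos(x₀) e₁ + B_k(t) e₀`. [folklore] -/
private def mode (k : ℕ) (t : ℝ) (x : EuclideanSpace ℝ (Fin 3)) : EuclideanSpace ℝ (Fin 3) :=
  shear (fun s => amp t ^ (k + 2) * Real.cos s) x + bee k t • eZero

/-- The `k`-th pressure `q_k(t, x) = Q_k(t) x₀ = ⟪Q_k e₀, x⟫`. [folklore] -/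
private def modePressure (k : ℕ) (t : ℝ) (x : EuclideanSpace ℝ (Fin 3)) : ℝ := ⟪cue k t • eZero, x⟫

/-- `0 < a(t) ≤ 1` for `t < 0`. [folklore] -/
private theorem amp_pos {t : ℝ} (ht : t < 0) : 0 < amp t := inv_pos.2 (by linarith)
/-- `a(t) ≤ 1` for `t < 0`. [folklore] -/
private theorem amp_le_one {t : ℝ} (ht : t < 0) : amp t ≤ 1 := inv_le_one_of_one_le₀ (by linarith)
/-- `a(t) ≤ 1/(-t)` (gradient rate) and `a(t) ≤ 1/√(-t)` (Type-I rate, `2√s ≤ 1 + s`). [folklore] -/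
private theorem amp_le_inv {t : ℝ} (ht : t < 0) : amp t ≤ 1 / (-t) := by
  rw [one_div]; exact inv_anti₀ (by linarith) (by linarith)

/-- `a(t) ≤ 1/√(-t)` for `t < 0` (`2√s ≤ 1 + s`). [folklore] -/
private theorem amp_le_inv_sqrt {t : ℝ} (ht : t < 0) : amp t ≤ 1 / Real.sqrt (-t) := by
  have hsq : Real.sqrt (-t) ^ 2 = -t := Real.sq_sqrt (by linarith)
  have h : Real.sqrt (-t) ≤ 1 - t := by nlinarith [sq_nonneg (Real.sqrt (-t) - 1)]
  rw [one_div]; exact inv_anti₀ (Real.sqrt_pos.2 (by linarith)) h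

/-- `a(t)² ≤ 1/√(-t)³` (pressure rate). [folklore] -/
private theorem amp_sq_le {t : ℝ} (ht : t < 0) : amp t ^ 2 ≤ 1 / Real.sqrt (-t) ^ 3 := by
  have hs : 0 < Real.sqrt (-t) := Real.sqrt_pos.2 (by linarith)
  have hsq : Real.sqrt (-t) ^ 2 = -t := Real.sq_sqrt (by linarith)
  have h3 : amp t ^ 2 ≤ 1 / Real.sqrt (-t) * (1 / (-t)) := by
    rw [sq]; exact mul_le_mul (amp_le_inv_sqrt ht) (amp_le_inv ht) (amp_pos ht).le (by positivity)
  refine h3.trans (le_of_eq ?_)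
  rw [pow_succ, hsq]; field_simp

/-- `a' = a²`, `(aⁿ)' = n aⁿ⁺¹`, `B_k' = -Q_k` on `t < 0`. [folklore] -/
private theorem hasDerivAt_amp_pow {t : ℝ} (ht : t < 0) (n : ℕ) :
    HasDerivAt (fun s => amp s ^ n) ((n : ℝ) * amp t ^ (n + 1)) t := by
  have h1 : HasDerivAt (fun s : ℝ => 1 - s) (-1) t := by simpa using (hasDerivAt_id t).const_sub 1
  have ha : HasDerivAt amp (amp t ^ 2) t := by
    refine (h1.fun_inv (by linarith)).congr_deriv ?_
    simp [amp, inv_pow]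
  refine (ha.fun_pow n).congr_deriv ?_
  rcases n with _ | n
  · simp
  · rw [Nat.add_sub_cancel]; push_cast; ring

/-- `B_k' = -Q_k` on `t < 0`. [folklore] -/
private theorem hasDerivAt_bee {t : ℝ} (ht : t < 0) (k : ℕ) : HasDerivAt (bee k) (-cue k t) t := by
  refine ((((hasDerivAt_amp_pow ht (k + 2)).const_mul ((k : ℝ) + 2)).add
    (hasDerivAt_amp_pow ht (k + 1))).fun_neg).congr_deriv ?_
  simp only [cue]; push_cast; ring

/-- `∂ₜ v_k = (k+2) a^{k+3} cos(x₀) e₁ - Q_k e₀`. [folklore] -/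
private theorem timeDeriv_mode {t : ℝ} (ht : t < 0) (k : ℕ) (x : EuclideanSpace ℝ (Fin 3)) :
    timeDeriv (mode k) t x =
      (((k : ℝ) + 2) * amp t ^ (k + 3) * Real.cos (x 0)) • eOne + (-cue k t) • eZero := by
  have h1 : HasDerivAt (fun s => amp s ^ (k + 2) * Real.cos (x 0))
      (((k : ℝ) + 2) * amp t ^ (k + 3) * Real.cos (x 0)) t := by
    refine ((hasDerivAt_amp_pow ht (k + 2)).mul_const (Real.cos (x 0))).congr_deriv ?_
    push_cast; ring
  exact ((h1.smul_const eOne).add ((hasDerivAt_bee ht k).smul_const eZero)).deriv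

/-- Profiles: `(c sin)' = c cos`, `(c cos)' = -c sin`, `(-c sin)' = -c cos`. [folklore] -/
private theorem hasDerivAt_sinP (c s : ℝ) : HasDerivAt (fun s => c * Real.sin s) (c * Real.cos s) s :=
  (Real.hasDerivAt_sin s).const_mul c
/-- `(c cos)' = -c sin`. [folklore] -/
private theorem hasDerivAt_cosP (c s : ℝ) : HasDerivAt (fun s => c * Real.cos s) (c * -Real.sin s) s :=
  (Real.hasDerivAt_cos s).const_mul c
/-- `(-c sin)' = -c cos`. [folklore] -/
private theorem hasDerivAt_cosP' (c s : ℝ) : HasDerivAt (fun s => c * -Real.sin s) (c * -Real.cos s) s :=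
  (Real.hasDerivAt_sin s).neg.const_mul c
/-- `D u(t)(x) h = (a cos(x₀) h₀) e₁`; `D v_k(t)(x) h = (-a^{k+2} sin(x₀) h₀) e₁`. [folklore] -/
private theorem fderiv_drift_apply (t : ℝ) (x h : EuclideanSpace ℝ (Fin 3)) :
    fderiv ℝ (drift t) x h = (amp t * Real.cos (x 0) * h 0) • eOne :=
  fderiv_shear_apply (hasDerivAt_sinP (amp t)) x h

/-- `D v_k(t)(x) = (-a^{k+2} sin(x₀)) dx₀ ⊗ e₁`. [folklore] -/
private theorem hasFDerivAt_mode (k : ℕ) (t : ℝ) (x : EuclideanSpace ℝ (Fin 3)) :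
    HasFDerivAt (mode k t) (((amp t ^ (k + 2) * -Real.sin (x 0)) •
      (EuclideanSpace.proj 0 : EuclideanSpace ℝ (Fin 3) →L[ℝ] ℝ)).smulRight eOne) x :=
  (hasFDerivAt_shear (hasDerivAt_cosP (amp t ^ (k + 2))) x).add_const _

/-- `D v_k(t)(x) h = (-a^{k+2} sin(x₀) h₀) e₁`. [folklore] -/
private theorem fderiv_mode_apply (k : ℕ) (t : ℝ) (x h : EuclideanSpace ℝ (Fin 3)) :
    fderiv ℝ (mode k t) x h = (amp t ^ (k + 2) * -Real.sin (x 0) * h 0) • eOne := by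
  rw [(hasFDerivAt_mode k t x).fderiv]; simp

/-- Components: `(u)₀ = 0`, `(v_k)₀ = B_k`, `(v_k)₁ = a^{k+2} cos(x₀)`. [folklore] -/
private theorem drift_apply_zero (t : ℝ) (x : EuclideanSpace ℝ (Fin 3)) : drift t x 0 = 0 := by simp [drift, shear]

/-- `(v_k)₀ = B_k`. [folklore] -/
private theorem mode_apply_zero (k : ℕ) (t : ℝ) (x : EuclideanSpace ℝ (Fin 3)) :
    mode k t x 0 = bee k t := by simp [mode, shear]

/-- `(v_k)₁ = a^{k+2} cos(x₀)`. [folklore] -/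
private theorem mode_apply_one (k : ℕ) (t : ℝ) (x : EuclideanSpace ℝ (Fin 3)) :
    mode k t x 1 = amp t ^ (k + 2) * Real.cos (x 0) := by simp [mode, shear]

/-- `Δ v_k = -a^{k+2} cos(x₀) e₁` and `∇ q_k = Q_k e₀`. [folklore] -/
private theorem laplacian_mode (k : ℕ) (t : ℝ) (x : EuclideanSpace ℝ (Fin 3)) :
    Δ (mode k t) x = (amp t ^ (k + 2) * -Real.cos (x 0)) • eOne := by
  have hV2 : ContDiff ℝ 2 (fun s => amp t ^ (k + 2) * Real.cos s) := contDiff_const.mul Real.contDiff_cos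
  have hmode : mode k t =
      shear (fun s => amp t ^ (k + 2) * Real.cos s) + fun _ => bee k t • eZero := by
    funext y; rfl
  rw [hmode, ContDiffAt.laplacian_add ((contDiff_shear hV2).contDiffAt) contDiffAt_const,
    laplacian_shear hV2 (hasDerivAt_cosP _) (hasDerivAt_cosP' _) x, InnerProductSpace.laplacian_const]
  simp

/-- `∇ q_k = Q_k e₀`. [folklore] -/
private theorem gradient_modePressure (k : ℕ) (t : ℝ) (x : EuclideanSpace ℝ (Fin 3)) :
    gradient (modePressure k t) x = cue k t • eZero := by
  have h : HasFDerivAt (fun y : EuclideanSpace ℝ (Fin 3) => ⟪cue k t • eZero, y⟫)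
      (innerSL ℝ (cue k t • eZero)) x := (innerSL ℝ (cue k t • eZero)).hasFDerivAt
  show gradient (fun y : EuclideanSpace ℝ (Fin 3) => ⟪cue k t • eZero, y⟫) x = _
  rw [gradient, h.fderiv]
  apply (InnerProductSpace.toDual ℝ (EuclideanSpace ℝ (Fin 3))).injective
  rw [LinearIsometryEquiv.apply_symm_apply]
  ext y
  simp [InnerProductSpace.toDual_apply_apply]

/-- A field with the derivative of a unidirectional shear `V(x₀) e₁` is divergence free
(`tr (V' dx₀ ⊗ e₁) = 0`); hence `div u = div v_k = 0`. [folklore] -/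
private theorem isDivFree_shear' {V V' : ℝ → ℝ} (hV : ∀ s, HasDerivAt V (V' s) s)
    {f : EuclideanSpace ℝ (Fin 3) → EuclideanSpace ℝ (Fin 3)}
    (hf : ∀ x, fderiv ℝ f x = fderiv ℝ (shear V) x) : VectorCalculus.IsDivFree f := by
  intro x
  rw [divergence_eq_sum_inner_fderiv (EuclideanSpace.basisFun (Fin 3) ℝ), hf]
  simp only [Fin.sum_univ_three, EuclideanSpace.basisFun_apply, fderiv_shear_apply hV,
    EuclideanSpace.inner_single_left, map_one, one_mul]
  simp [eOne]

/-- `div u = 0`. [folklore] -/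
private theorem isDivFree_drift (t : ℝ) : VectorCalculus.IsDivFree (drift t) :=
  isDivFree_shear' (hasDerivAt_sinP (amp t)) fun _ => rfl

/-- `div v_k = 0`. [folklore] -/
private theorem isDivFree_mode (k : ℕ) (t : ℝ) : VectorCalculus.IsDivFree (mode k t) :=
  isDivFree_shear' (hasDerivAt_cosP (amp t ^ (k + 2))) fun x => by
    rw [(hasFDerivAt_mode k t x).fderiv, (hasFDerivAt_shear (hasDerivAt_cosP _) x).fderiv]

/-- **Linearised momentum equation** `∂ₜv_k + (u·∇)v_k + (v_k·∇)u = Δv_k - ∇q_k` on `t < 0`: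
`(u·∇)v_k = 0`, `(v_k·∇)u = a cos(x₀) B_k e₁`; the `e₁`-component is `(k+2)a^{k+3} + aB_k = -a^{k+2}`,
the `e₀`-component `B_k' = -Q_k`. [folklore] -/
private theorem momentum_mode {t : ℝ} (ht : t < 0) (k : ℕ) (x : EuclideanSpace ℝ (Fin 3)) :
    timeDeriv (mode k) t x + convect (drift t) (mode k t) x + convect (mode k t) (drift t) x =
      Δ (mode k t) x - gradient (modePressure k t) x := by
  rw [timeDeriv_mode ht, convect_apply, fderiv_mode_apply, drift_apply_zero, convect_apply,
    fderiv_drift_apply, mode_apply_zero, laplacian_mode, gradient_modePressure]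
  ext i
  fin_cases i
  · simp [eOne, eZero]
  · simp [eOne, eZero, bee]
    ring
  · simp [eOne, eZero]

/-- Joint smoothness on `(-∞, 0) × ℝ³` of `a`, the drift, the modes and the pressures. [folklore] -/
private theorem contDiffOn_amp_fst {n : WithTop ℕ∞} :
    ContDiffOn ℝ n (fun p : ℝ × EuclideanSpace ℝ (Fin 3) => amp p.1) (Iio 0 ×ˢ univ) :=
  (contDiffOn_const.sub contDiffOn_fst).inv fun p hp => by
    have : p.1 < 0 := hp.1
    exact ne_of_gt (by linarith)

/-- `(t, x) ↦ x₀` is smooth. [folklore] -/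
private theorem contDiff_coord_zero_snd {n : WithTop ℕ∞} :
    ContDiff ℝ n (fun p : ℝ × EuclideanSpace ℝ (Fin 3) => p.2 0) :=
  (contDiff_piLp_apply (p := 2) (i := (0 : Fin 3))).comp contDiff_snd

/-- The drift is jointly smooth on `t < 0`. [folklore] -/
private theorem contDiffOn_drift {n : WithTop ℕ∞} : ContDiffOn ℝ n (uncurry drift) (Iio 0 ×ˢ univ) := by
  have h : ContDiffOn ℝ n (fun p : ℝ × EuclideanSpace ℝ (Fin 3) =>
      (amp p.1 * Real.sin (p.2 0)) • eOne) (Iio 0 ×ˢ univ) :=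
    (contDiffOn_amp_fst.mul (Real.contDiff_sin.comp contDiff_coord_zero_snd).contDiffOn).smul
      contDiffOn_const
  exact h

/-- The modes are jointly smooth on `t < 0`. [folklore] -/
private theorem contDiffOn_mode (k : ℕ) {n : WithTop ℕ∞} :
    ContDiffOn ℝ n (uncurry (mode k)) (Iio 0 ×ˢ univ) := by
  have hb : ContDiffOn ℝ n (fun p : ℝ × EuclideanSpace ℝ (Fin 3) => bee k p.1) (Iio 0 ×ˢ univ) :=
    ((contDiffOn_const.mul (contDiffOn_amp_fst.pow _)).add (contDiffOn_amp_fst.pow _)).neg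
  have h : ContDiffOn ℝ n (fun p : ℝ × EuclideanSpace ℝ (Fin 3) =>
      (amp p.1 ^ (k + 2) * Real.cos (p.2 0)) • eOne + bee k p.1 • eZero) (Iio 0 ×ˢ univ) :=
    (((contDiffOn_amp_fst.pow _).mul
      (Real.contDiff_cos.comp contDiff_coord_zero_snd).contDiffOn).smul contDiffOn_const).add
      (hb.smul contDiffOn_const)
  exact h

/-- The pressures are jointly smooth on `t < 0`. [folklore] -/
private theorem contDiffOn_modePressure (k : ℕ) {n : WithTop ℕ∞} :
    ContDiffOn ℝ n (uncurry (modePressure k)) (Iio 0 ×ˢ univ) := by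
  have hc : ContDiffOn ℝ n (fun p : ℝ × EuclideanSpace ℝ (Fin 3) => cue k p.1) (Iio 0 ×ˢ univ) :=
    (contDiffOn_const.mul (contDiffOn_amp_fst.pow _)).add
      (contDiffOn_const.mul (contDiffOn_amp_fst.pow _))
  have h : ContDiffOn ℝ n (fun p : ℝ × EuclideanSpace ℝ (Fin 3) => ⟪cue k p.1 • eZero, p.2⟫)
      (Iio 0 ×ˢ univ) := (hc.smul contDiffOn_const).inner ℝ contDiffOn_snd
  exact h

/-- Drift bounds: `‖u‖ ≤ 1/√(-t)` (Type-I, `C = 1`) and `‖∇u‖ ≤ 1/(-t)`. [folklore] -/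
private theorem hasTypeITimeDecay_drift : HasTypeITimeDecay 1 drift := fun t ht x => by
  have h1 : ‖drift t x‖ ≤ amp t := by
    show ‖(amp t * Real.sin (x 0)) • eOne‖ ≤ amp t
    rw [norm_smul, norm_eOne, mul_one, Real.norm_eq_abs, abs_mul, abs_of_nonneg (amp_pos ht).le]
    nlinarith [Real.abs_sin_le_one (x 0), abs_nonneg (Real.sin (x 0)), amp_pos ht]
  exact h1.trans (amp_le_inv_sqrt ht)

/-- `‖∇u(t, x)‖ ≤ 1/(-t)`. [folklore] -/
private theorem norm_fderiv_drift_le {t : ℝ} (ht : t < 0) (x : EuclideanSpace ℝ (Fin 3)) :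
    ‖fderiv ℝ (drift t) x‖ ≤ 1 / (-t) := by
  refine (ContinuousLinearMap.opNorm_le_bound _ (amp_pos ht).le fun h => ?_).trans (amp_le_inv ht)
  rw [fderiv_drift_apply, norm_smul, norm_eOne, mul_one, Real.norm_eq_abs, abs_mul, abs_mul,
    abs_of_nonneg (amp_pos ht).le]
  have h0 : |h 0| ≤ ‖h‖ := by simpa [Real.norm_eq_abs] using PiLp.norm_apply_le h 0
  calc amp t * |Real.cos (x 0)| * |h 0| ≤ amp t * 1 * ‖h‖ :=
        mul_le_mul (mul_le_mul_of_nonneg_left (Real.abs_cos_le_one _) (amp_pos ht).le) h0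
          (abs_nonneg _) (by have := amp_pos ht; positivity)
    _ = amp t * ‖h‖ := by ring

/-- Tempered growth of `(v_k, q_k)` with `K = (k+3)²`: `‖v_k‖ ≤ K/√(-t)`, `|q_k| ≤ K(1+‖x‖)/√(-t)³`. [folklore] -/
private theorem growth_mode (k : ℕ) : ∃ K : ℝ, ∀ t < 0, ∀ x : EuclideanSpace ℝ (Fin 3),
    ‖mode k t x‖ ≤ K / Real.sqrt (-t) + K * (1 + ‖x‖) / (-t) ∧
      |modePressure k t x| ≤ K / (-t) + K * (1 + ‖x‖) / Real.sqrt (-t) ^ 3 := by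
  refine ⟨((k : ℝ) + 3) ^ 2, fun t ht x => ?_⟩
  have ha := (amp_pos ht).le
  have ha1 := amp_le_one ht
  have hk : (0 : ℝ) ≤ k := Nat.cast_nonneg k
  have ht' : 0 < -t := by linarith
  have hs : 0 < Real.sqrt (-t) := Real.sqrt_pos.2 ht'
  have hp2 : amp t ^ (k + 2) ≤ amp t := pow_le_of_le_one ha ha1 (Nat.succ_ne_zero _)
  have hp1 : amp t ^ (k + 1) ≤ amp t := pow_le_of_le_one ha ha1 (Nat.succ_ne_zero _)
  have hq3 : amp t ^ (k + 3) ≤ amp t ^ 2 := pow_le_pow_of_le_one ha ha1 (by omega)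
  have hq2 : amp t ^ (k + 2) ≤ amp t ^ 2 := pow_le_pow_of_le_one ha ha1 (by omega)
  constructor
  · have h1 : ‖mode k t x‖ ≤ ((k : ℝ) + 3) ^ 2 * amp t := by
      show ‖(amp t ^ (k + 2) * Real.cos (x 0)) • eOne + bee k t • eZero‖ ≤ _
      refine (norm_add_le _ _).trans ?_
      rw [norm_smul, norm_smul, norm_eOne, norm_eZero, mul_one, mul_one, Real.norm_eq_abs,
        Real.norm_eq_abs, abs_mul, abs_of_nonneg (pow_nonneg ha _), bee, abs_neg,
        abs_of_nonneg (show (0 : ℝ) ≤ ((k : ℝ) + 2) * amp t ^ (k + 2) + amp t ^ (k + 1) by positivity)]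
      have hc : amp t ^ (k + 2) * |Real.cos (x 0)| ≤ amp t ^ (k + 2) :=
        mul_le_of_le_one_right (pow_nonneg ha _) (Real.abs_cos_le_one _)
      have hk2 : ((k : ℝ) + 4) * amp t ≤ ((k : ℝ) + 3) ^ 2 * amp t :=
        mul_le_mul_of_nonneg_right (by nlinarith) ha
      have hk3 : ((k : ℝ) + 2) * amp t ^ (k + 2) ≤ ((k : ℝ) + 2) * amp t :=
        mul_le_mul_of_nonneg_left hp2 (by positivity)
      linarith
    have h2 : ((k : ℝ) + 3) ^ 2 * amp t ≤ ((k : ℝ) + 3) ^ 2 / Real.sqrt (-t) := by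
      rw [div_eq_mul_one_div]
      exact mul_le_mul_of_nonneg_left (amp_le_inv_sqrt ht) (by positivity)
    have h3 : 0 ≤ ((k : ℝ) + 3) ^ 2 * (1 + ‖x‖) / (-t) := by positivity
    linarith
  · have h1 : |modePressure k t x| ≤ cue k t * ‖x‖ := by
      refine (abs_real_inner_le_norm _ _).trans (le_of_eq ?_)
      rw [norm_smul, norm_eZero, mul_one, Real.norm_eq_abs, abs_of_nonneg]
      simp only [cue]; positivity
    have h2 : cue k t ≤ ((k : ℝ) + 3) ^ 2 / Real.sqrt (-t) ^ 3 := by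
      have : cue k t ≤ ((k : ℝ) + 3) ^ 2 * amp t ^ 2 := by simp only [cue]; nlinarith
      refine this.trans ?_
      rw [div_eq_mul_one_div]
      exact mul_le_mul_of_nonneg_left (amp_sq_le ht) (by positivity)
    have h3 : cue k t * ‖x‖ ≤ ((k : ℝ) + 3) ^ 2 / Real.sqrt (-t) ^ 3 * (1 + ‖x‖) :=
      mul_le_mul h2 (by linarith [norm_nonneg x]) (norm_nonneg x) (by positivity)
    have h4 : 0 ≤ ((k : ℝ) + 3) ^ 2 / (-t) := by positivity
    calc |modePressure k t x| ≤ ((k : ℝ) + 3) ^ 2 / Real.sqrt (-t) ^ 3 * (1 + ‖x‖) := h1.trans h3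
      _ = ((k : ℝ) + 3) ^ 2 * (1 + ‖x‖) / Real.sqrt (-t) ^ 3 := by ring
      _ ≤ _ := by linarith

/-- The `e₁`-component of a combination of modes. [folklore] -/
private theorem sum_smul_mode_apply_one {ι : Type*} (s : Finset ι) (c : ι → ℝ) (k : ι → ℕ) (t : ℝ)
    (x : EuclideanSpace ℝ (Fin 3)) :
    (∑ i ∈ s, c i • mode (k i) t x) 1 = ∑ i ∈ s, c i * (amp t ^ (k i + 2) * Real.cos (x 0)) := by
  induction s using Finset.cons_induction with
  | empty => simp
  | cons a s ha ih =>
    rw [Finset.sum_cons, Finset.sum_cons, PiLp.add_apply, PiLp.smul_apply, ih, mode_apply_one,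
      smul_eq_mul]

/-- Slice-constancy of `∑ cᵢ v_{i}` at time `t` forces `∑ cᵢ a(t)^{i+2} = 0` (compare `x = 0`, `x = π e₀`). [folklore] -/
private theorem sum_eq_zero_of_slice_constant {N : ℕ} (c : Fin (N + 1) → ℝ) {t : ℝ}
    (h : ∃ b : EuclideanSpace ℝ (Fin 3), ∀ x, ∑ i, c i • mode (i : ℕ) t x = b) :
    ∑ i, c i * amp t ^ ((i : ℕ) + 2) = 0 := by
  obtain ⟨b, hb⟩ := h
  have h0 := congrArg (fun v : EuclideanSpace ℝ (Fin 3) => v 1) (hb 0)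
  have hπ := congrArg (fun v : EuclideanSpace ℝ (Fin 3) => v 1) (hb (EuclideanSpace.single 0 Real.pi))
  simp only at h0 hπ
  rw [sum_smul_mode_apply_one] at h0 hπ
  simp only [PiLp.zero_apply, Real.cos_zero, mul_one] at h0
  simp only [PiLp.single_apply, if_true, Real.cos_pi, mul_neg, mul_one, Finset.sum_neg_distrib] at hπ
  linarith

/-- Distinct powers are linearly independent on `(0, 1)` (a polynomial with infinitely many roots). [folklore] -/
private theorem coeff_eq_zero_of_sum_pow_eq_zero {N : ℕ} (c : Fin (N + 1) → ℝ)
    (h : ∀ y ∈ Ioo (0 : ℝ) 1, ∑ i, c i * y ^ ((i : ℕ) + 2) = 0) : c = 0 := by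
  classical
  set P : Polynomial ℝ := ∑ i, Polynomial.C (c i) * Polynomial.X ^ ((i : ℕ) + 2) with hP
  have heval : ∀ y, P.eval y = ∑ i, c i * y ^ ((i : ℕ) + 2) := fun y => by
    simp [hP, Polynomial.eval_finsetSum]
  have hroots : Set.Infinite {y | P.IsRoot y} := by
    refine (Ioo_infinite (zero_lt_one' ℝ)).mono fun y hy => ?_
    simp only [Set.mem_setOf_eq, Polynomial.IsRoot.def, heval]
    exact h y hy
  have hP0 : P = 0 := Polynomial.eq_zero_of_infinite_isRoot P hroots
  funext j
  have hcoeff : P.coeff ((j : ℕ) + 2) = c j := by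
    simp only [hP, Polynomial.finsetSum_coeff, Polynomial.coeff_C_mul_X_pow]
    rw [Finset.sum_eq_single j]
    · simp
    · intro i _ hij
      rw [if_neg]
      intro hh
      exact hij (Fin.ext (by omega))
    · intro hj
      exact absurd (Finset.mem_univ j) hj
  rw [← hcoeff, hP0, Polynomial.coeff_zero, Pi.zero_apply]

/-- Refutes `SymmetryModuliCount.FiniteTangentModuli` (stmt-NavierStokesRegularity-4055) [refuted-misstated]:
around the smooth divergence-free Type-I drift `u(t,x) = (1-t)⁻¹ sin(x₀) e₁` (`C = 1`, `|u| ≤ 1/√(-t)`,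
`‖∇u‖ ≤ 1/(-t)`; not a Navier–Stokes solution, as the item allows) the linearised system has, for every
`N`, the `N + 1` tempered classical solutions `v_k = (1-t)^{-(k+2)} cos(x₀) e₁ + B_k(t) e₀`,
`q_k = -B_k'(t) x₀`, `B_k = -((k+2)(1-t)^{-(k+2)} + (1-t)^{-(k+1)})`, `k = 0, …, N`
(`‖v_k‖ ≤ (k+3)²/√(-t)`, `|q_k| ≤ (k+3)²(1+‖x‖)/√(-t)³`), and no nontrivial combination is constant on
every slice (`∑ c_k (1-t)^{-(k+2)} ≡ 0` on `t < 0` forces `c = 0`).  Witness: `C = 1`, `u = drift`,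
`v i = mode i`, `q i = modePressure i`.  Mechanism: the quotient "modulo slice-wise constants" removes only
EXACT parasitic modes `b(t)`; around a drift with `(b·∇)u ≢ const` they are dressed (`b + w_b`) and survive,
so the tempered class mod constants is infinite-dimensional (likewise around any nonzero `u ∈ 𝒜_C` via the
Galilean Jacobi fields `β' − (β·∇)u`).  Repaired statement C′ — the witness MISSES it (its `B_k(t) e₀` part
is not mild): same hypotheses, perturbations in the linearised-MILD (Oseen/Duhamel) gauge
`∀ s t, s < t → t < 0 → ∀ x, v i t x = heatFlow (v i s) (t - s) x - ∫ τ in Set.Ioo s t, ∫ y,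
(oseenKernel (t - τ) (x - y) (u τ y) (v i τ y) + oseenKernel (t - τ) (x - y) (v i τ y) (u τ y))`
added to each `(v i, q i)`, conclusion plain dependence `∃ c ≠ 0, ∀ t < 0, ∀ x, ∑ i, c i • v i t x = 0`;
whether C′ holds for general Type-I drifts is the open CFT-type claim the item meant to isolate
(filed as `FiniteTangentModuliMild` in the crux's `Disproof.lean`). [folklore] -/
theorem SymmetryModuliCountFiniteTangentModuli_refuted :
    ¬ Summit.NavierStokesRegularity.NavierStokesRegularity.Theses.SymmetryModuliCount.FiniteTangentModuli := by
  intro h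
  obtain ⟨N, hN⟩ := h 1 drift contDiffOn_drift (fun t _ => isDivFree_drift t)
    hasTypeITimeDecay_drift (fun t ht x => norm_fderiv_drift_le ht x)
  obtain ⟨c, hc, hdep⟩ := hN (fun i => mode (i : ℕ)) (fun i => modePressure (i : ℕ)) fun i =>
    ⟨contDiffOn_mode _, contDiffOn_modePressure _, growth_mode _, fun t _ => isDivFree_mode _ t,
      fun t ht x => momentum_mode ht _ x⟩
  refine hc (coeff_eq_zero_of_sum_pow_eq_zero c fun y hy => ?_)
  have ht : 1 - y⁻¹ < 0 := by have : 1 < y⁻¹ := (one_lt_inv₀ hy.1).2 hy.2; linarith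
  have hamp : amp (1 - y⁻¹) = y := by simp [amp]
  simpa [hamp] using sum_eq_zero_of_slice_constant c (hdep _ ht)

end Summit.NavierStokesRegularity.NavierStokesRegularity.Theorems
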